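import Summits.CriticalPhenomena.PercolationContinuityZ3.Theorems.PercFiniteBoxLROCerf2015BoxLRO16Scale
import HarnessLib

/-!
# Line `pair-decay-long-arms-dense` (crux `NearLinearTwoClusterDecay`, U(1/6)), frontier stub:
# jump-world two-cluster decay at aspect `n^48`, BOND percolation on `ℤ³`

Helper file (`--supports stmt-CriticalPhenomena-5785`). The open stub `stub_pairDecayJumpWorld` of the
line asks, in the jump world `θ(p_c) > 0`, for two-cluster decay at aspect `n^{7/6}`; this file
certifies what the tree's bond transcription of Cerf's machinery (R. Cerf, Ann. Probab. 43 (2015),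
§§7–10; tree files `…PercFiniteBoxLROCerf2015BoxLRO16{Tools,Decay,Scale}`) gives at EVERY `p < 1`
with `θ(p) > 0`: the union-form two-cluster event — two sites of `Λ(n)` joined inside `Λ(n^48)` to
`∂ⁱⁿΛ(n^48)` but not to each other — has probability tending to `0`
(`twoClusterDecay_aspect48_of_theta_pos`). Proof: for configurations on lattice edges the event lies
in `⋃_{z,z' ∈ Λ(n)} twoArmsBox n (n^48 − n) z z'` (`real_twoCluster_le_sum_twoArmsBox`, union bound);
Cerf's Cor. 7.2 count `Σ_{z,z'} P ≤ K n^{24} τ(n^48 − 2n − 2)`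
(`Cerf2015BoxLRO16.sum_real_twoArmsBox_three_le`) and the two-arms decay `τ(m) √m → 0`
(`Cerf2015BoxLRO16.real_edgeTwoArms_mul_sqrt_le`), with `n^{24} ≤ 2 √(n^48 − 2n − 2)`. The aspect
`48 = 2 · 24` is exactly where the polynomial loss `n^{24}` of the count is absorbed by the exponent
`1/2`; the strict improvement `o(m^{−1/2})` of Cerf's Theorem 1.1 gives the limit `0`.
This file introduces no definition.

## References

* R. Cerf, *A lower bound on the two-arms exponent for critical percolation on the lattice*, Ann.
  Probab. 43 (2015) 2458–2480, Cor. 7.2, Thm 1.1 and §10 (arXiv:1306.3105) [Cerf2015].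
-/

noncomputable section

namespace Summit.CriticalPhenomena.PercolationContinuityZ3.Theorems

open MeasureTheory Filter Topology
open Literature.Probability.LatticeModels Literature.Probability.Percolation

/-- **Encoding bridge and union bound** (Cerf 2015, Cor. 7.2, first step, bond version on `ℤ^d`): for
`k ≤ m`, the probability that two sites `x, x'` of `Λ(k)` are joined inside `Λ(m)` (tree event
`openConnIn`) to `∂ⁱⁿΛ(m)` but not to each other is at most
`Σ_{z,z' ∈ Λ(k)} P_p(twoArmsBox k (m − k) z z')` — for configurations on lattice edges (almost all,
`DCT16.real_mono_of_forall_subset_edgeSet`) `ω ∈ openConnIn ↑Λ(m) a b` reads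
`b ∈ openClusterIn (withinGraph (zdGraph d) ↑Λ(m)) ω a` (`openConnIn_eq_openConnVia`,
`openClusterIn_withinGraph_eq_top`). [cite: Cerf2015, Cor 7.2] -/
theorem real_twoCluster_le_sum_twoArmsBox {d : ℕ} (p : unitInterval) {k m : ℕ} (hkm : k ≤ m) :
    (bondPercolation (zdGraph d) p).real
      {ω | ∃ x ∈ box d k, ∃ x' ∈ box d k, ∃ y ∈ innerBoundary (zdGraph d) (box d m),
        ∃ y' ∈ innerBoundary (zdGraph d) (box d m),
          ω ∈ openConnIn ↑(box d m) x y ∧ ω ∈ openConnIn ↑(box d m) x' y' ∧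
          ω ∉ openConnIn ↑(box d m) x x'} ≤
      ∑ z ∈ box d k, ∑ z' ∈ box d k,
        (bondPercolation (zdGraph d) p).real (AKN.twoArmsBox k (m - k) z z') := by
  have hkm' : k + (m - k) = m := Nat.add_sub_cancel' hkm
  have hsub : box d k ⊆ box d m := box_mono d hkm
  calc (bondPercolation (zdGraph d) p).real
        {ω | ∃ x ∈ box d k, ∃ x' ∈ box d k, ∃ y ∈ innerBoundary (zdGraph d) (box d m),
          ∃ y' ∈ innerBoundary (zdGraph d) (box d m),
            ω ∈ openConnIn ↑(box d m) x y ∧ ω ∈ openConnIn ↑(box d m) x' y' ∧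
            ω ∉ openConnIn ↑(box d m) x x'}
      ≤ (bondPercolation (zdGraph d) p).real
          (⋃ z ∈ box d k, ⋃ z' ∈ box d k, AKN.twoArmsBox k (m - k) z z') := by
        refine DCT16.real_mono_of_forall_subset_edgeSet (zdGraph d) p fun ω hω h => ?_
        obtain ⟨x, hx, x', hx', y, hy, y', hy', hxy, hx'y', hxx'⟩ := h
        have key : ∀ {a b : Site d}, a ∈ box d m → (ω ∈ openConnIn ↑(box d m) a b ↔
            b ∈ openClusterIn (withinGraph (zdGraph d) ↑(box d m)) ω a) := by
          intro a b ha
          rw [openConnIn_eq_openConnVia (Finset.mem_coe.2 ha),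
            openClusterIn_withinGraph_eq_top (zdGraph d) _ hω]
          exact Iff.rfl
        refine Set.mem_iUnion₂.2 ⟨x, hx, Set.mem_iUnion₂.2 ⟨x', hx', ?_⟩⟩
        simp only [AKN.twoArmsBox, hkm', Set.mem_setOf_eq]
        exact ⟨fun h => hxx' ((key (hsub hx)).2 h), ⟨y, hy, (key (hsub hx)).1 hxy⟩,
          ⟨y', hy', (key (hsub hx')).1 hx'y'⟩⟩
    _ ≤ ∑ z ∈ box d k, (bondPercolation (zdGraph d) p).real
          (⋃ z' ∈ box d k, AKN.twoArmsBox k (m - k) z z') :=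
        measureReal_biUnion_finset_le _ _
    _ ≤ ∑ z ∈ box d k, ∑ z' ∈ box d k,
          (bondPercolation (zdGraph d) p).real (AKN.twoArmsBox k (m - k) z z') :=
        Finset.sum_le_sum fun z _ => measureReal_biUnion_finset_le _ _

/-- **Jump-world (supercritical) two-cluster decay at aspect `n^48`, bond percolation on `ℤ³`**
(Cerf 2015, Cor. 7.2 with Thm 1.1 run at a parameter with `θ(p) > 0`, as in §10): for `p < 1` with
`θ(p) > 0`, the probability that two sites of `Λ(n)` are joined inside `Λ(⌈n^48⌉)` to `∂ⁱⁿΛ(⌈n^48⌉)`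
but not to each other tends to `0` — union bound over the pair, the count
`Σ_{z,z'} P_p(twoArmsBox) ≤ K n^{24} τ(n^48 − 2n − 2)` and `τ(m) √m → 0`, `n^{24} ≤ 2√(n^48 − 2n − 2)`.
[cite: Cerf2015, Cor 7.2 and Thm 1.1] -/
theorem twoClusterDecay_aspect48_of_theta_pos (p : unitInterval) (hp1 : (p : ℝ) < 1)
    (hθ : 0 < theta (zdGraph 3) 0 p) :
    Filter.Tendsto (fun n : ℕ => (bondPercolation (zdGraph 3) p).real
      {ω | ∃ x ∈ box 3 n, ∃ x' ∈ box 3 n, ∃ y ∈ innerBoundary (zdGraph 3) (box 3 ⌈(n : ℝ) ^ (48 : ℝ)⌉₊),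
        ∃ y' ∈ innerBoundary (zdGraph 3) (box 3 ⌈(n : ℝ) ^ (48 : ℝ)⌉₊),
          ω ∈ openConnIn ↑(box 3 ⌈(n : ℝ) ^ (48 : ℝ)⌉₊) x y ∧
          ω ∈ openConnIn ↑(box 3 ⌈(n : ℝ) ^ (48 : ℝ)⌉₊) x' y' ∧
          ω ∉ openConnIn ↑(box 3 ⌈(n : ℝ) ^ (48 : ℝ)⌉₊) x x'}) Filter.atTop (nhds 0) := by
  -- `p > 0`: at `p = 0` nothing percolates
  have hp0 : 0 < (p : ℝ) := by
    rcases eq_or_lt_of_le p.2.1 with h | h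
    · exfalso
      have hp : p = 0 := Subtype.ext h.symm
      rw [hp, theta_bot] at hθ
      exact lt_irrefl _ hθ
    · exact h
  -- the outer box is `Λ(n^48)`
  have hceil : ∀ n : ℕ, ⌈(n : ℝ) ^ (48 : ℝ)⌉₊ = n ^ 48 := fun n => by
    rw [Real.rpow_ofNat]; exact_mod_cast Nat.ceil_natCast (n ^ 48)
  simp only [hceil]
  -- the constant of the box two-arms sum
  obtain ⟨K₂, hK₂⟩ : ∃ K₂ : ℝ,
      K₂ = (3 : ℝ) ^ 18 * 7 ^ 7 * 6 ^ 6 / ((p : ℝ) ^ 9 * theta (zdGraph 3) 0 p ^ 6) := ⟨_, rfl⟩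
  have hK₂0 : 0 < K₂ := by rw [hK₂]; positivity
  have hK₂ne : K₂ ≠ 0 := hK₂0.ne'
  rw [Metric.tendsto_atTop]
  intro ε hε
  have hε' : 0 < ε / (12 * K₂) := by positivity
  obtain ⟨m₀, hm₀1, hm₀⟩ := Cerf2015BoxLRO16.real_edgeTwoArms_mul_sqrt_le p hp0 hp1 hθ hε'
  refine ⟨m₀ + 5, fun n hn => ?_⟩
  -- integer bookkeeping: `N = n^48 ≥ 5n`, `M = N − 2n − 2`
  have hn1 : 1 ≤ n := by omega
  have hn5 : 5 ≤ n := by omega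
  obtain ⟨N, hN⟩ : ∃ N : ℕ, N = n ^ 48 := ⟨_, rfl⟩
  have h5N : 5 * n ≤ N := by
    rw [hN]
    calc 5 * n ≤ n * n := Nat.mul_le_mul_right n hn5
      _ = n ^ 2 := (sq n).symm
      _ ≤ n ^ 48 := Nat.pow_le_pow_right hn1 (by norm_num)
  obtain ⟨M, hM⟩ : ∃ M : ℕ, M = N - n - n - 2 := ⟨_, rfl⟩
  have hnN : n ≤ N := by omega
  have hℓ : n + 3 ≤ N - n := by omega
  have hm₀M : m₀ ≤ M := by omega
  have hN4M : N ≤ 4 * M := by omega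
  rw [← hN]
  -- the two-arms statistics at scale `M`: `T √M ≤ 3 ε'`
  obtain ⟨T, hT⟩ : ∃ T : ℝ, T = ∑ i : Fin 3, (bondPercolation (zdGraph 3) p).real (AKN.edgeTwoArms i M) :=
    ⟨_, rfl⟩
  have hT0 : 0 ≤ T := by rw [hT]; exact Finset.sum_nonneg fun _ _ => measureReal_nonneg
  have hTM : T * Real.sqrt M ≤ 3 * (ε / (12 * K₂)) := by
    rw [hT, Finset.sum_mul]
    calc ∑ i : Fin 3, (bondPercolation (zdGraph 3) p).real (AKN.edgeTwoArms i M) * Real.sqrt M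
        ≤ ∑ _i : Fin 3, ε / (12 * K₂) := Finset.sum_le_sum fun i _ => hm₀ M hm₀M i
      _ = 3 * (ε / (12 * K₂)) := by
          rw [Finset.sum_const, Finset.card_univ, Fintype.card_fin, nsmul_eq_mul]; push_cast; ring
  -- `n^24 ≤ 2 √M`
  have hn24 : (n : ℝ) ^ 24 ≤ 2 * Real.sqrt M := by
    have h4 : ((n : ℝ) ^ 24) ^ 2 ≤ (2 * Real.sqrt M) ^ 2 := by
      have hNR : ((n : ℝ) ^ 24) ^ 2 = (N : ℝ) := by rw [hN]; push_cast; ring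
      have h4R : (N : ℝ) ≤ 4 * (M : ℝ) := by exact_mod_cast hN4M
      calc ((n : ℝ) ^ 24) ^ 2 = (N : ℝ) := hNR
        _ ≤ 4 * (M : ℝ) := h4R
        _ = (2 * Real.sqrt M) ^ 2 := by rw [mul_pow, Real.sq_sqrt (Nat.cast_nonneg _)]; norm_num
    exact (pow_le_pow_iff_left₀ (by positivity) (by positivity) two_ne_zero).1 h4
  -- Cerf's count of the box two-arms sum
  have hsum := Cerf2015BoxLRO16.sum_real_twoArmsBox_three_le p hp0 hθ (k := n) (ℓ := N - n) hn1 hℓ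
  rw [← hK₂, ← hM, ← hT] at hsum
  have hmain : (bondPercolation (zdGraph 3) p).real
      {ω | ∃ x ∈ box 3 n, ∃ x' ∈ box 3 n, ∃ y ∈ innerBoundary (zdGraph 3) (box 3 N),
        ∃ y' ∈ innerBoundary (zdGraph 3) (box 3 N),
          ω ∈ openConnIn ↑(box 3 N) x y ∧ ω ∈ openConnIn ↑(box 3 N) x' y' ∧
          ω ∉ openConnIn ↑(box 3 N) x x'} ≤ ε / 2 := by
    calc _ ≤ ∑ z ∈ box 3 n, ∑ z' ∈ box 3 n,
          (bondPercolation (zdGraph 3) p).real (AKN.twoArmsBox n (N - n) z z') :=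
          real_twoCluster_le_sum_twoArmsBox p hnN
      _ ≤ K₂ * (n : ℝ) ^ 24 * T := hsum
      _ ≤ K₂ * (2 * Real.sqrt M) * T :=
          mul_le_mul_of_nonneg_right (mul_le_mul_of_nonneg_left hn24 hK₂0.le) hT0
      _ = 2 * K₂ * (T * Real.sqrt M) := by ring
      _ ≤ 2 * K₂ * (3 * (ε / (12 * K₂))) := mul_le_mul_of_nonneg_left hTM (by positivity)
      _ = ε / 2 := by field_simp; ring
  rw [Real.dist_eq, sub_zero, abs_of_nonneg measureReal_nonneg]
  linarith

end Summit.CriticalPhenomena.PercolationContinuityZ3.Theorems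

end
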